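import Literature.Computability.Cryptography.PeriodFindingBlock
import Literature.Computability.Cryptography.PeriodFindingCircuit
import HarnessLib

/-!
# Period finding by eigenvalue estimation of shifts, VIII: placing the block in the sandwich register

Family `PQC` / quantum-advantage barrier `PPolyOracles`; eighth file towards the discharge of
`Literature.Barriers.QuantumAdvantage.aaronsonChen2017_lem75_quantum`. The structured wires
`BW S` of the classical block (`PeriodFindingBlock.lean`) are placed injectively in the register
`x (y Z) ρ` of the sandwich circuit (`PeriodFindingCircuit.lean`): the control `(u, s)` on control
wire `finProdFinEquiv (u, s)`, the offset bit `(u, i)` on offset wire `finProdFinEquiv (u, i)`,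
and the prefix, step and answer registers on the work wires through explicit sums and products of
`Fin`s (`WIdx`, `workEquiv`; the affine formulas of the uniformity proof are their values). The
block is compiled into a Clifford+T circuit with oracle gates (`blockCirc`,
`RtOp.compileList` of `RazTalBlocks.lean`), and its semantics relative to any oracle `A`
(`ocEval_blockOps`) is transported (`OSim.ocEval_map_comp`, `OSim.compileList_mulVec_basisState`)
to the hypotheses of the read-out law (`sandwich_law_struct`):

* `blockCirc_mulVec_coinInput` — `V |x (y Z) 0^m⟩ = |x (y Z) (R y Z)⟩` (hypothesis `hV`);
* `blockR_eq_iff` — `R y Z = R y' Z ↔ ∀ u, F_u (X_u(y, Z)) = F_u (X_u(y', Z))` with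
  `F_u (v) = ([cpre j ++ bits_L(v) ∈ A])_{j<L}` (towards hypothesis `hR`);
* `xval_eq_emod` — `X_u = (Z_u − ∑_s y_{u,s} 2^{lvl s}) mod 2^{L_u}` (Kitaev's exponent).

## References

* A. Yu. Kitaev, arXiv:quant-ph/9511026 (1995), §3 Lemma 10 [Kitaev1995].
* E. Bernstein, U. Vazirani, SIAM J. Comput. 26 (1997), §8.3 [BernsteinVazirani1997SICOMP].
* M. A. Nielsen, I. L. Chuang, *Quantum Computation and Quantum Information*, CUP 2010, §3.2.5
  [NielsenChuang2010].
-/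

noncomputable section

namespace Literature.Computability.Cryptography

namespace PeriodFinding

open QuantumComplexity QuantumComplexity.RazTalMachine QuantumComplexity.RevSim QuantumComplexity.OSim
  Finset Function Matrix Kitaev1995

variable (S : BSpec) (n : ℕ)

/-! ### The layout -/

/-- Control wires. [folklore] -/
abbrev k₁ : ℕ := S.nU * S.K
/-- Offset wires. [folklore] -/
abbrev k₂ : ℕ := S.nU * S.Ltop
/-- The size of a step region: `d`, `s` (each `Ltop`), `c` (`Ltop + 1`). [folklore] -/
abbrev ssz : ℕ := S.Ltop + (S.Ltop + (S.Ltop + 1))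
/-- The size of a unit region: `K` step regions and the answer register. [folklore] -/
abbrev usz : ℕ := S.K * ssz S + S.Ltop
/-- The number of work wires: prefix blocks and unit regions. [folklore] -/
abbrev mW : ℕ := S.Ltop * S.plen + S.nU * usz S
/-- The number of wires of the register `x (y Z) ρ`. [folklore] -/
abbrev NN : ℕ := n + ((k₁ S + k₂ S) + mW S)

/-- Structured work indices: a prefix position, or a unit with either a step and one of its three
registers, or an answer bit. [folklore] -/
abbrev WIdx : Type :=
  Fin (S.Ltop * S.plen) ⊕ (Fin S.nU × ((Fin S.K × (Fin S.Ltop ⊕ (Fin S.Ltop ⊕ Fin (S.Ltop + 1)))) ⊕ Fin S.Ltop))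

/-- The step region as a `Fin`. [folklore] -/
def stepEquiv : (Fin S.Ltop ⊕ (Fin S.Ltop ⊕ Fin (S.Ltop + 1))) ≃ Fin (ssz S) :=
  (Equiv.sumCongr (Equiv.refl _) finSumFinEquiv).trans finSumFinEquiv

/-- The unit region as a `Fin`. [folklore] -/
def unitEquiv : ((Fin S.K × (Fin S.Ltop ⊕ (Fin S.Ltop ⊕ Fin (S.Ltop + 1)))) ⊕ Fin S.Ltop) ≃ Fin (usz S) :=
  (Equiv.sumCongr (((Equiv.refl _).prodCongr (stepEquiv S)).trans finProdFinEquiv) (Equiv.refl _)).trans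
    finSumFinEquiv

/-- **The work wires as a `Fin`.** [folklore] -/
def workEquiv : WIdx S ≃ Fin (mW S) :=
  (Equiv.sumCongr (Equiv.refl _) (((Equiv.refl _).prodCongr (unitEquiv S)).trans finProdFinEquiv)).trans
    finSumFinEquiv

/-- **The structured code of a wire**: a control index, an offset index, or a work index. [folklore] -/
def code : BW S → Fin (k₁ S) ⊕ (Fin (k₂ S) ⊕ WIdx S)
  | .ctrl u s => Sum.inl (finProdFinEquiv (u, s))
  | .zbit u i => Sum.inr (Sum.inl (finProdFinEquiv (u, i)))
  | .pre j p => Sum.inr (Sum.inr (Sum.inl (finProdFinEquiv (j, p))))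
  | .dreg u s i => Sum.inr (Sum.inr (Sum.inr (u, Sum.inl (s, Sum.inl i))))
  | .sreg u s i => Sum.inr (Sum.inr (Sum.inr (u, Sum.inl (s, Sum.inr (Sum.inl i)))))
  | .creg u s i => Sum.inr (Sum.inr (Sum.inr (u, Sum.inl (s, Sum.inr (Sum.inr i)))))
  | .yreg u i => Sum.inr (Sum.inr (Sum.inr (u, Sum.inr i)))

/-- Decoding a work index. [folklore] -/
def ofWIdx : WIdx S → BW S
  | Sum.inl q => BW.pre (finProdFinEquiv.symm q).1 (finProdFinEquiv.symm q).2
  | Sum.inr (u, Sum.inl (s, Sum.inl i)) => BW.dreg u s i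
  | Sum.inr (u, Sum.inl (s, Sum.inr (Sum.inl i))) => BW.sreg u s i
  | Sum.inr (u, Sum.inl (s, Sum.inr (Sum.inr i))) => BW.creg u s i
  | Sum.inr (u, Sum.inr i) => BW.yreg u i

/-- Decoding then coding a work index. [folklore] -/
theorem code_ofWIdx (q : WIdx S) : code S (ofWIdx S q) = Sum.inr (Sum.inr q) := by
  rcases q with q | ⟨u, ⟨s, i | i | i⟩ | i⟩ <;> simp [code, ofWIdx, -finProdFinEquiv_symm_apply]

/-- **The code is injective.** [folklore] -/
theorem code_injective : Injective (code S) := by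
  intro a b h
  cases a <;> cases b <;> simp [code] at h <;> first
    | (obtain ⟨rfl, rfl⟩ := h; rfl)
    | (obtain ⟨rfl, rfl, rfl⟩ := h; rfl)

/-- The work wire of a work index. [folklore] -/
def workWire (l : Fin (mW S)) : Fin (NN S n) := Fin.natAdd n (Fin.natAdd (k₁ S + k₂ S) l)

/-- **Placing the codes**: control wires, offset wires, work wires of the register `x (y Z) ρ`. [folklore] -/
def place : Fin (k₁ S) ⊕ (Fin (k₂ S) ⊕ WIdx S) → Fin (NN S n)
  | Sum.inl j => yWire n (k₁ S) (k₂ S) (mW S) j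
  | Sum.inr (Sum.inl j) => zWire n (k₁ S) (k₂ S) (mW S) j
  | Sum.inr (Sum.inr q) => workWire S n (workEquiv S q)

/-- **The wire of a structured wire.** [folklore] -/
def finAddr (a : BW S) : Fin (NN S n) := place S n (code S a)

variable {S n}

/-- Value of a control wire. [folklore] -/
theorem val_yWire (j : Fin (k₁ S)) : (yWire n (k₁ S) (k₂ S) (mW S) j : ℕ) = n + j := by
  simp [yWire, coinWire]

/-- Value of an offset wire. [folklore] -/
theorem val_zWire (j : Fin (k₂ S)) : (zWire n (k₁ S) (k₂ S) (mW S) j : ℕ) = n + (k₁ S + j) := by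
  simp [zWire, coinWire]

/-- Value of a work wire. [folklore] -/
theorem val_workWire (l : Fin (mW S)) : (workWire S n l : ℕ) = n + ((k₁ S + k₂ S) + l) := by
  simp [workWire]

/-- **The placement is injective.** [folklore] -/
theorem place_injective : Injective (place S n) := by
  intro v v' h
  have hv := congrArg Fin.val h
  rcases v with j | j | q <;> rcases v' with j' | j' | q' <;>
    simp only [place, val_yWire, val_zWire, val_workWire] at hv
  · exact congrArg Sum.inl (Fin.ext (by omega))
  · have := j.isLt; omega
  · have := j.isLt; omega
  · have := j'.isLt; omega
  · exact congrArg (Sum.inr ∘ Sum.inl) (Fin.ext (by omega))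
  · have := j.isLt; omega
  · have := j'.isLt; omega
  · have := j'.isLt; omega
  · exact congrArg (Sum.inr ∘ Sum.inr) ((workEquiv S).injective (Fin.ext (by omega)))

/-- **The wires of the structured wires are pairwise distinct.** [folklore] -/
theorem finAddr_injective : Injective (finAddr S n) :=
  (place_injective (S := S) (n := n)).comp (code_injective S)

/-- Every non-input wire is the wire of a structured wire: control wires. [folklore] -/
theorem yWire_mem_range (j : Fin (k₁ S)) : yWire n (k₁ S) (k₂ S) (mW S) j ∈ Set.range (finAddr S n) :=
  ⟨BW.ctrl (finProdFinEquiv.symm j).1 (finProdFinEquiv.symm j).2, by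
    simp [finAddr, code, place, -finProdFinEquiv_symm_apply]⟩

/-- Offset wires. [folklore] -/
theorem zWire_mem_range (j : Fin (k₂ S)) : zWire n (k₁ S) (k₂ S) (mW S) j ∈ Set.range (finAddr S n) :=
  ⟨BW.zbit (finProdFinEquiv.symm j).1 (finProdFinEquiv.symm j).2, by
    simp [finAddr, code, place, -finProdFinEquiv_symm_apply]⟩

/-- Work wires. [folklore] -/
theorem workWire_mem_range (l : Fin (mW S)) : workWire S n l ∈ Set.range (finAddr S n) :=
  ⟨ofWIdx S ((workEquiv S).symm l), by simp [finAddr, code_ofWIdx, place]⟩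

/-! ### The compiled block -/

variable (S n)

/-- Every operation of the block is classical or a query. [folklore] -/
theorem blockOps_isCl : ∀ op ∈ blockOps S, IsCl op := by
  intro op hop
  simp only [blockOps, List.mem_append, List.mem_map] at hop
  rcases hop with (⟨a, -, rfl⟩ | hop) | ⟨a, -, rfl⟩
  · trivial
  · obtain ⟨a, -, rfl⟩ := List.mem_map.1 hop
    trivial
  · trivial

/-- The query wires and the answer wire of a query are pairwise distinct. [folklore] -/
theorem qWires_qTgt_nodup (a : Σ u : Fin S.nU, Fin (S.L u)) : (qWires S a ++ [qTgt S a]).Nodup := by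
  rw [List.nodup_append]
  refine ⟨?_, List.nodup_singleton _, fun b hb c hc e => ?_⟩
  · rw [qWires, List.nodup_append]
    refine ⟨(List.nodup_finRange _).map fun p p' h => ?_, (List.nodup_finRange _).map fun i i' h => ?_,
      fun b hb c hc e => ?_⟩
    · simpa using h
    · simpa using h
    · subst e
      simp only [preWires, List.mem_map] at hb
      obtain ⟨p, -, rfl⟩ := hb
      simp [xWires] at hc
  · rw [List.mem_singleton] at hc
    subst hc; subst e
    exact qTgt_not_mem_qWires a a hb

/-- Every operation of the block is well formed. [folklore] -/
theorem blockOps_rwf : ∀ op ∈ blockOps S, op.WF := by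
  intro op hop
  simp only [blockOps, List.mem_append, List.mem_map] at hop
  rcases hop with (⟨a, ha, rfl⟩ | hop) | ⟨a, ha, rfl⟩
  · exact wOps_wf a ha
  · obtain ⟨a, -, rfl⟩ := List.mem_map.1 hop
    exact qWires_qTgt_nodup S a
  · exact wf_reverse wOps_wf a ha

/-- **The block placed in the register.** [folklore] -/
def blockOpsN : List (RtOp (Fin (NN S n))) := (blockOps S).map (RtOp.map (finAddr S n))

/-- Placed operations are classical or queries. [folklore] -/
theorem blockOpsN_isCl : ∀ op ∈ blockOpsN S n, IsCl op := by
  intro op hop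
  obtain ⟨op', hop', rfl⟩ := List.mem_map.1 hop
  exact (blockOps_isCl S op' hop').map _

/-- Placed operations are well formed. [folklore] -/
theorem blockOpsN_wf : ∀ op ∈ blockOpsN S n, op.WF := by
  intro op hop
  obtain ⟨op', hop', rfl⟩ := List.mem_map.1 hop
  exact (blockOps_rwf S op' hop').map_of_injOn fun a _ a' _ h => finAddr_injective h

/-- **The block as a Clifford+T circuit with oracle gates.** [cite: BernsteinVazirani1997SICOMP, §8.3] -/
def blockCirc : QCircuit cliffordT (NN S n) := ⟨RtOp.compileList (blockOpsN S n) (blockOpsN_wf S n)⟩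

/-! ### The semantics in the register -/

/-- The controls read off the flat control string. [folklore] -/
def yOfFlat (yf : QReg (k₁ S)) : Fin S.nU → Fin S.K → Bool := fun u s => yf (finProdFinEquiv (u, s))

/-- The offset bits read off the flat offset string. [folklore] -/
def zOfFlat (Z : QReg (k₂ S)) : Fin S.nU → Fin S.Ltop → Bool := fun u i => Z (finProdFinEquiv (u, i))

variable {S n}

/-- **The basis label `x (y Z) 0^m` pulled back to the structured wires is the initial assignment.** [folklore] -/
theorem coinInput_comp_finAddr (x : QReg n) (yf : QReg (k₁ S)) (Z : QReg (k₂ S)) :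
    (coinInput x (Fin.append yf Z) : QReg (NN S n)) ∘ finAddr S n = w₀ S (yOfFlat S yf) (zOfFlat S Z) := by
  funext a
  cases a with
  | ctrl u s =>
    show coinInput x (Fin.append yf Z) (yWire n (k₁ S) (k₂ S) (mW S) _) = _
    rw [yWire, coinInput_coinWire, Fin.append_left]
    rfl
  | zbit u i =>
    show coinInput x (Fin.append yf Z) (zWire n (k₁ S) (k₂ S) (mW S) _) = _
    rw [zWire, coinInput_coinWire, Fin.append_right]
    rfl
  | pre j p => exact coinInput_work x _ _
  | dreg u s i => exact coinInput_work x _ _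
  | sreg u s i => exact coinInput_work x _ _
  | creg u s i => exact coinInput_work x _ _
  | yreg u i => exact coinInput_work x _ _

variable (S n)

/-- **The work-register content written by the block** relative to `A` on `x (y Z) 0^m`. [folklore] -/
def blockR (A : Language Bool) (yf : QReg (k₁ S)) (Z : QReg (k₂ S)) : QReg (mW S) := fun l =>
  wFin S (yOfFlat S yf) (zOfFlat S Z) A (ofWIdx S ((workEquiv S).symm l))

variable {S n}

/-- **The block acts on `x (y Z) 0^m` as `|x (y Z) 0^m⟩ ↦ |x (y Z) (R y Z)⟩`** (hypothesis `hV` of the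
read-out law). [cite: BernsteinVazirani1997SICOMP, §8.3] -/
theorem blockCirc_mulVec_coinInput (A : Language Bool) (x : QReg n) (yf : QReg (k₁ S)) (Z : QReg (k₂ S)) :
    (blockCirc S n).toMatrix A *ᵥ basisState (coinInput x (Fin.append yf Z)) =
      basisState (tri x (Fin.append yf Z) (blockR S A yf Z)) := by
  rw [blockCirc, compileList_mulVec_basisState A _ (blockOpsN_isCl S n) (blockOpsN_wf S n)]
  congr 1
  funext q
  by_cases hq : q ∈ Set.range (finAddr S n)
  · obtain ⟨a, rfl⟩ := hq
    rw [blockOpsN, show ocEval A ((blockOps S).map (RtOp.map (finAddr S n)))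
        (coinInput x (Fin.append yf Z)) (finAddr S n a) =
        ocEval A (blockOps S) ((coinInput x (Fin.append yf Z) : QReg (NN S n)) ∘ finAddr S n) a from
      congrFun (ocEval_map_comp A finAddr_injective _ _) a, coinInput_comp_finAddr, ocEval_blockOps]
    cases a with
    | ctrl u s =>
      show yOfFlat S yf u s = tri x (Fin.append yf Z) _ (yWire n (k₁ S) (k₂ S) (mW S) _)
      rw [tri_yWire]
      rfl
    | zbit u i =>
      show zOfFlat S Z u i = tri x (Fin.append yf Z) _ (zWire n (k₁ S) (k₂ S) (mW S) _)
      rw [tri_zWire]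
      rfl
    | pre j p =>
      show _ = tri x _ (blockR S A yf Z) (workWire S n _)
      rw [workWire, tri_work, blockR, Equiv.symm_apply_apply, ofWIdx, Equiv.symm_apply_apply]
    | dreg u s i =>
      show _ = tri x _ (blockR S A yf Z) (workWire S n _)
      rw [workWire, tri_work, blockR, Equiv.symm_apply_apply]
      rfl
    | sreg u s i =>
      show _ = tri x _ (blockR S A yf Z) (workWire S n _)
      rw [workWire, tri_work, blockR, Equiv.symm_apply_apply]
      rfl
    | creg u s i =>
      show _ = tri x _ (blockR S A yf Z) (workWire S n _)
      rw [workWire, tri_work, blockR, Equiv.symm_apply_apply]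
      rfl
    | yreg u i =>
      show _ = tri x _ (blockR S A yf Z) (workWire S n _)
      rw [workWire, tri_work, blockR, Equiv.symm_apply_apply]
      rfl
  · rw [blockOpsN, ocEval_map_apply_of_not_mem_range A _ _ _ hq]
    induction q using Fin.addCases with
    | left i => rw [coinInput_castAdd, tri_castAdd]
    | right q =>
      exfalso
      induction q using Fin.addCases with
      | left c =>
        induction c using Fin.addCases with
        | left j => exact hq (yWire_mem_range j)
        | right j => exact hq (zWire_mem_range j)
      | right l => exact hq (workWire_mem_range l)

/-! ### The fibres of `R` -/

variable (S)

/-- The tuple of answers of unit `u` as a function of the value of `X_u`: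
`([cpre j ++ bits_L(v) ∈ A])_{j < L}`. [cite: BernsteinVazirani1997SICOMP, §8.3] -/
def Fu (A : Language Bool) (u : Fin S.nU) (v : ℕ) : List Bool :=
  List.ofFn fun j : Fin (S.L u) => A.boolIndicator (S.cpre j ++ List.ofFn fun i : Fin (S.L u) => v.testBit i)

variable {S}

/-- The answers are the answer function at `X_u`. [folklore] -/
theorem ans_eq_getElem_Fu (A : Language Bool) (y : Fin S.nU → Fin S.K → Bool)
    (Z : Fin S.nU → Fin S.Ltop → Bool) (u : Fin S.nU) (j : Fin (S.L u)) :
    ans S y Z A u j = (Fu S A u (xval S y Z u)).getD j false := by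
  rw [Fu, List.getD_eq_getElem?_getD, List.getElem?_ofFn]
  simp [j.isLt, ans, xbits]

/-- **The fibres of the work-register content**: `R y Z = R y' Z` iff every unit has the same
tuple of answers, i.e. `F_u (X_u(y,Z)) = F_u (X_u(y',Z))` for all `u`. [folklore] -/
theorem blockR_eq_iff (A : Language Bool) (yf yf' : QReg (k₁ S)) (Z : QReg (k₂ S)) :
    blockR S A yf Z = blockR S A yf' Z ↔
      ∀ u, Fu S A u (xval S (yOfFlat S yf) (zOfFlat S Z) u) = Fu S A u (xval S (yOfFlat S yf') (zOfFlat S Z) u) := by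
  constructor
  · intro h u
    apply List.ext_getElem (by simp [Fu])
    intro j hj _
    have hj' : j < S.L u := by simpa [Fu] using hj
    have key := congrFun h (workEquiv S (Sum.inr (u, Sum.inr (up S ⟨j, hj'⟩))))
    simp only [blockR, Equiv.symm_apply_apply, ofWIdx, wFin, Fin.val_castLE, dif_pos hj'] at key
    rw [ans_eq_getElem_Fu, ans_eq_getElem_Fu, List.getD_eq_getElem?_getD, List.getD_eq_getElem?_getD,
      List.getElem?_eq_getElem hj, List.getElem?_eq_getElem (by simpa [Fu] using hj')] at key
    simpa using key
  · intro h
    funext l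
    simp only [blockR]
    rcases (workEquiv S).symm l with q | ⟨u, ⟨s, i | i | i⟩ | i⟩
    · rfl
    · rfl
    · rfl
    · rfl
    · simp only [ofWIdx, wFin]
      split_ifs with hi
      · rw [ans_eq_getElem_Fu, ans_eq_getElem_Fu, h u]
      · rfl

/-! ### The accumulated shift -/

/-- The addend of a step is minus its control's power of two, modulo `2^L`. [cite: Kitaev1995, §3 Lemma 10] -/
theorem dval_modEq (y : Fin S.nU → Fin S.K → Bool) (u : Fin S.nU) (s : Fin S.K) :
    ((dval S y u s : ℕ) : ℤ) ≡ -(((y u s).toNat * 2 ^ S.lvl s : ℕ) : ℤ) [ZMOD (2 ^ S.L u : ℕ)] := by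
  unfold dval
  by_cases hl : S.lvl s < S.L u
  · cases hy : y u s
    · simp
    · rw [if_pos ⟨hl, rfl⟩]
      have hle : 2 ^ S.lvl s ≤ 2 ^ S.L u := Nat.pow_le_pow_right (by norm_num) hl.le
      rw [Int.modEq_iff_dvd]
      refine ⟨-1, ?_⟩
      push_cast [Nat.cast_sub hle, Bool.toNat_true]
      ring
  · have h0 : (if S.lvl s < S.L u ∧ y u s = true then 2 ^ S.L u - 2 ^ S.lvl s else 0) = 0 := if_neg fun h => hl h.1
    rw [h0]
    cases hy : y u s
    · simp
    · rw [Int.modEq_iff_dvd]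
      simp only [Bool.toNat_true, one_mul, Nat.cast_zero, sub_zero, Nat.cast_pow, Nat.cast_ofNat, dvd_neg]
      exact pow_dvd_pow 2 (not_lt.1 hl)

/-- The partial exponent `∑_{s < m} y_{u,s} 2^{lvl s}`. [folklore] -/
def expUpTo (y : Fin S.nU → Fin S.K → Bool) (u : Fin S.nU) (m : ℕ) : ℕ :=
  ∑ s ∈ range m, if h : s < S.K then (y u ⟨s, h⟩).toNat * 2 ^ S.lvl ⟨s, h⟩ else 0

/-- **The accumulator is the offset minus the partial exponent, modulo `2^L`.** [cite: Kitaev1995, §3 Lemma 10] -/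
theorem acc_modEq (y : Fin S.nU → Fin S.K → Bool) (Z : Fin S.nU → Fin S.Ltop → Bool) (u : Fin S.nU) :
    ∀ m, ((acc S y Z u m : ℕ) : ℤ) ≡ (zval S y Z u : ℤ) - expUpTo y u m [ZMOD (2 ^ S.L u : ℕ)]
  | 0 => by simp [acc, expUpTo]
  | m + 1 => by
    have ih := acc_modEq y Z u m
    rw [acc, expUpTo, sum_range_succ, ← expUpTo, Int.natCast_mod]
    refine (Int.mod_modEq _ _).trans ?_
    push_cast
    by_cases hm : m < S.K
    · rw [dif_pos hm, dif_pos hm]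
      have hd := dval_modEq y u ⟨m, hm⟩
      calc ((acc S y Z u m : ℕ) : ℤ) + (dval S y u ⟨m, hm⟩ : ℕ)
          ≡ ((zval S y Z u : ℤ) - expUpTo y u m) + -(((y u ⟨m, hm⟩).toNat * 2 ^ S.lvl ⟨m, hm⟩ : ℕ) : ℤ)
            [ZMOD (2 ^ S.L u : ℕ)] := ih.add hd
        _ = _ := by push_cast; ring
    · rw [dif_neg hm, dif_neg hm]
      push_cast
      simpa using ih

/-- **`X_u = (Z_u − ∑_s y_{u,s} 2^{lvl s}) mod 2^{L_u}`** (the shift by Kitaev's exponent).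
[cite: Kitaev1995, §3 Lemma 10] -/
theorem xval_eq_emod (y : Fin S.nU → Fin S.K → Bool) (Z : Fin S.nU → Fin S.Ltop → Bool) (u : Fin S.nU) :
    ((xval S y Z u : ℕ) : ℤ) =
      ((zval S y Z u : ℤ) - ∑ s : Fin S.K, (((y u s).toNat * 2 ^ S.lvl s : ℕ) : ℤ)) % (2 ^ S.L u : ℕ) := by
  have h := acc_modEq y Z u S.K
  have hexp : (expUpTo y u S.K : ℤ) = ∑ s : Fin S.K, (((y u s).toNat * 2 ^ S.lvl s : ℕ) : ℤ) := by
    rw [expUpTo, ← Fin.sum_univ_eq_sum_range (fun s => if h : s < S.K then (y u ⟨s, h⟩).toNat * 2 ^ S.lvl ⟨s, h⟩ else 0)]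
    push_cast
    refine sum_congr rfl fun s _ => ?_
    rw [dif_pos s.isLt]
    simp only [Fin.eta, Nat.cast_mul, Nat.cast_pow, Nat.cast_ofNat]
  rw [xval, ← hexp]
  unfold Int.ModEq at h
  rw [← h]
  exact (Int.emod_eq_of_lt (by positivity) (by exact_mod_cast acc_lt u S.K)).symm

end PeriodFinding

end Literature.Computability.Cryptography

end
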